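import Literature.NumberTheory.Automorphic.RankinSelbergLocalEpsilonProofs
import HarnessLib

/-!
# Local Rankin–Selberg `ε`-factors: `∃! (e, a)` versus `e ≠ 0`, and the additive measure `μ = 0`

Complements to `RankinSelbergLocalEpsilonProofs` (reductions for the named fact
`hasRSEpsilon_ne_zero` of `RankinSelbergLocal`; Jacquet–Piatetski-Shapiro–Shalika 1983,
Thm. 2.7 (iii); Cogdell, *Analytic theory of `L`-functions for `GL_n`*, §3.1, Thm. 3.2 and the
paragraph after it, "`ε(s, π × π', ψ)` is a monomial function of the form `c q^{-fs}`") and to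
`RankinSelbergLocalUniqueness` (uniqueness halves). Theorems only; no definitions, no named facts
(D-0026).

## What is proved

* `HasRSEpsilon.ne_zero_of_existsUnique`, `HasRSEpsilon.existsUnique_iff_exists_ne_zero`: at the
  level of the PREDICATE `HasRSEpsilon` (hence for any measures and reusable verbatim by corrected
  restatements of the facts), uniqueness of the pair `(e, a)` forces `e ≠ 0` (were `(0, a)` a
  solution, so would be `(0, a + 1)`, `hasRSEpsilon_zero_iff`), and for `V' ≠ 0`
  `(∃! (e, a), HasRSEpsilon … e a) ↔ ∃ e a, e ≠ 0 ∧ HasRSEpsilon … e a`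
  (`←` is `HasRSEpsilon.existsUnique_of_exists`). So an `∃! (e, a)`-shaped `ε`-fact carries
  "`ε(0) ≠ 0`" as a corollary and the latter need not be a separate fact.
* The additive measure `μ = 0` (`1 ≤ m`, `2 ≤ n - m`, so that the unipotent average of
  `Ψ_{n-m-1}` is against `0^{⊗}` and the contragredient side of the functional equation vanishes,
  `rsZetaTilde_measure_zero`). `RankinSelbergLocalEpsilonProofs` shows that `γ = 0` and the
  `ε`-data `(0, a)` then OCCUR (given `L`-polynomials and a central character); here the converse:
  they are FORCED. Given an `L`-polynomial of `(π, π')` at `ν` (which supplies a zeta integral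
  `Ψ ≢ 0`, `HasRSLFactor.exists_ratFunc_ne_zero`):
  - `HasRSGamma.eq_zero_of_measure_zero`, `hasRSGamma_measure_zero_iff`: `HasRSGamma … 0 ν γ ↔
    γ = 0 ∧ π' has a central character`; hence `existsUnique_hasRSGamma_measure_zero`: the
    mis-stated fact `existsUnique_hasRSGamma` (refuted at `ν = 0` in
    `RankinSelbergLocalGammaCounterexample`) HOLDS at `μ = 0` — with the spurious `γ = 0`;
  - `HasRSEpsilon.eq_zero_of_measure_zero`, `hasRSEpsilon_measure_zero_iff`: every solution of
    `HasRSEpsilon … 0 ν e a` has `e = 0`, and the solutions are exactly `e = 0 ∧ (L-data)`;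
  - `not_existsUnique_hasRSEpsilon_measure_zero` (no `L`-data hypothesis needed): `∃! (e, a)`
    FAILS at `μ = 0` for every `ν`; so the closed fact `existsUnique_hasRSEpsilon` fails at
    `(ν, μ = 0)` whenever its hypotheses on `π, π', ψ` are met
    (`not_existsUnique_hasRSEpsilon_measure_zero_of_hyp`), complementing its failure at `ν = 0`
    (`not_hasRSEpsilon_zero_measure`), and `hasRSEpsilon_ne_zero` at `μ = 0` is equivalent to
    the absence of `L`-data (`hasRSEpsilon_ne_zero_measure_zero_iff`).

## References

* H. Jacquet, I. I. Piatetski-Shapiro, J. Shalika, *Rankin–Selberg convolutions*, Amer. J. Math.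
  105 (1983), 367–464, Thm. 2.7. [JacquetPiatetskiShapiroShalika1983]
* J. W. Cogdell, *Analytic theory of `L`-functions for `GL_n`*, in J. Bernstein, S. Gelbart (eds.),
  *An Introduction to the Langlands Program*, Birkhäuser, §3.1, Thm. 3.1–3.2 (held, read).
-/

set_option autoImplicit false

open MeasureTheory Polynomial
  Literature.NumberTheory.GaloisRepresentations.IsNonarchimedeanLocalField

noncomputable section

namespace Literature.NumberTheory.Automorphic

/-! ### `∃! (e, a)` versus `e ≠ 0`, for the predicate `HasRSEpsilon` -/

section ExistsUnique

variable {F : Type*} [Field F] [ValuativeRel F] [TopologicalSpace F] [IsNonarchimedeanLocalField F]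
  {n m : ℕ} {V : Type*} [AddCommGroup V] [Module ℂ V] {V' : Type*} [AddCommGroup V'] [Module ℂ V']
  [MeasurableSpace (GL (Fin m) F ⧸ upperUnitriangular (Fin m) F)]
  {hmn : m < n} {π : Representation ℂ (GL (Fin n) F) V} {π' : Representation ℂ (GL (Fin m) F) V'}
  {ψ : AddChar F Circle} {ν : Measure (GL (Fin m) F ⧸ upperUnitriangular (Fin m) F)}
  [MeasurableSpace F] {μ : Measure F}

/-- **Uniqueness of the monomial data forces `ε(0) ≠ 0`** (predicate level, any measures): if
the pair `(e, a)` with `HasRSEpsilon hmn π π' ψ μ ν e a` is unique, every solution has `e ≠ 0` —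
were `(0, a)` a solution, `(0, a + 1)` would be another (`hasRSEpsilon_zero_iff`). In Jacquet–
Piatetski-Shapiro–Shalika 1983, Thm. 2.7 (iii) (Cogdell, §3.1, after Thm. 3.2), `ε = c q^{-fs}` is
a unit of `ℂ[q^{-s}, q^{s}]`, i.e. `c ≠ 0`; here it comes out of the `∃!` shape alone. [cite: JacquetPiatetskiShapiroShalika1983, Thm. 2.7 (iii)] -/
theorem HasRSEpsilon.ne_zero_of_existsUnique
    (hu : ∃! ea : ℂ × ℤ, HasRSEpsilon hmn π π' ψ μ ν ea.1 ea.2) {e : ℂ} {a : ℤ}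
    (h : HasRSEpsilon hmn π π' ψ μ ν e a) : e ≠ 0 := by
  rintro rfl
  have h1 : ((0 : ℂ), a) = ((0 : ℂ), a + 1) :=
    hu.unique (y₁ := ((0 : ℂ), a)) (y₂ := ((0 : ℂ), a + 1)) h
      ((hasRSEpsilon_zero_iff a (a + 1)).1 h)
  have h2 := congrArg Prod.snd h1
  simp at h2

/-- **`∃! (e, a)` is existence with `e ≠ 0`** (for `V' ≠ 0`, so that the central character of
`π'` is determined): `→` by `HasRSEpsilon.ne_zero_of_existsUnique`, `←` by
`HasRSEpsilon.existsUnique_of_exists` (`RankinSelbergLocalUniqueness`: `L`-polynomials, `γ` and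
the monomial data of a solution with `e ≠ 0` are unique). [cite: JacquetPiatetskiShapiroShalika1983, Thm. 2.7 (iii)] -/
theorem HasRSEpsilon.existsUnique_iff_exists_ne_zero [Nontrivial V'] :
    (∃! ea : ℂ × ℤ, HasRSEpsilon hmn π π' ψ μ ν ea.1 ea.2) ↔
      ∃ (e : ℂ) (a : ℤ), e ≠ 0 ∧ HasRSEpsilon hmn π π' ψ μ ν e a := by
  refine ⟨fun hu => ?_, fun h => HasRSEpsilon.existsUnique_of_exists h⟩
  obtain ⟨⟨e, a⟩, hea, -⟩ := id hu
  exact ⟨e, a, HasRSEpsilon.ne_zero_of_existsUnique hu hea, hea⟩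

end ExistsUnique

/-! ### The additive measure `μ = 0`: `γ = 0` and `e = 0` are forced -/

section MeasureZero

variable {F : Type*} [Field F] [ValuativeRel F] [TopologicalSpace F] [IsNonarchimedeanLocalField F]
  {n m : ℕ} {V : Type*} [AddCommGroup V] [Module ℂ V] {V' : Type*} [AddCommGroup V'] [Module ℂ V']
  [MeasurableSpace (GL (Fin m) F ⧸ upperUnitriangular (Fin m) F)] [MeasurableSpace F]
  {hmn : m < n} {π : Representation ℂ (GL (Fin n) F) V} {π' : Representation ℂ (GL (Fin m) F) V'}
  {ψ : AddChar F Circle} {ν : Measure (GL (Fin m) F ⧸ upperUnitriangular (Fin m) F)}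

/-- **At `μ = 0` the `γ` of `HasRSGamma` is forced to vanish** (`1 ≤ m`, `2 ≤ n - m`): an
`L`-polynomial `P` of `(π, π')` at `ν` supplies Whittaker data with `Ψ(s; W, W') = R(q^{-s})`,
`R ≠ 0` (`HasRSLFactor.exists_ratFunc_ne_zero`); the contragredient side is `0` on every left
half-plane (`rsZetaTilde_measure_zero`), so its interpolant is `R̃ = 0`
(`EqOnLeftHalfPlane.unique`), and `0 = ω_{π'}(-1)^{n-1} γ R` gives `γ = 0`. [folklore] -/
theorem HasRSGamma.eq_zero_of_measure_zero (hm : 0 < m) (hj : 0 < n - m - 1) {P : ℂ[X]}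
    (hP : HasRSLFactor hmn π π' ψ ν P) {γ : RatFunc ℂ}
    (h : HasRSGamma hmn π π' ψ (0 : Measure F) ν γ) : γ = 0 := by
  classical
  have hq : 1 < residueFieldCard F := one_lt_residueFieldCard F
  obtain ⟨ω, -, H⟩ := h
  obtain ⟨k, Λ, Λ', v, v', Q, hΛ, hΛ', -, hb⟩ := hP.2.2
  choose R Rt hR hRt hE using fun i => H (Λ i) (hΛ i) (Λ' i) (hΛ' i) (v i) (v' i)
  obtain ⟨i, hi⟩ := hP.exists_ratFunc_ne_zero hb hR
  have hRt0 : Rt i = 0 :=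
    (hRt i).unique hq
      ⟨0, fun s _ => by
        dsimp only
        rw [rsZetaTilde_measure_zero hmn hm hj, evalAtQ, RatFunc.eval_zero]⟩
  have e1 := hE i
  rw [hRt0] at e1
  have hC : RatFunc.C ((((ω (centerNegOne m F)) : ℂˣ) : ℂ) ^ (n - 1)) ≠ 0 :=
    (_root_.map_ne_zero RatFunc.C).mpr (pow_ne_zero _ (Units.ne_zero _))
  rcases mul_eq_zero.mp e1.symm with h1 | h2
  · exact (mul_eq_zero.mp h1).resolve_left hC
  · exact absurd h2 hi

/-- **The functional equation at `μ = 0`, exactly** (`1 ≤ m`, `2 ≤ n - m`, an `L`-polynomial of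
`(π, π')` at `ν` given): `HasRSGamma hmn π π' ψ 0 ν γ ↔ γ = 0 ∧ π'` has a central character
(`→`: `HasRSGamma.eq_zero_of_measure_zero`; `←`: `hasRSGamma_zero_measure_zero`). [folklore] -/
theorem hasRSGamma_measure_zero_iff (hm : 0 < m) (hj : 0 < n - m - 1) {P : ℂ[X]}
    (hP : HasRSLFactor hmn π π' ψ ν P) (γ : RatFunc ℂ) :
    HasRSGamma hmn π π' ψ (0 : Measure F) ν γ ↔
      γ = 0 ∧ ∃ ω : Subgroup.center (GL (Fin m) F) →* ℂˣ, π'.HasCentralCharacter ω := by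
  refine ⟨fun h => ⟨h.eq_zero_of_measure_zero hm hj hP, ?_⟩, ?_⟩
  · obtain ⟨ω, hω, -⟩ := h
    exact ⟨ω, hω⟩
  · rintro ⟨rfl, ω, hω⟩
    exact hasRSGamma_zero_measure_zero hm hj hω hP

/-- **The mis-stated `existsUnique_hasRSGamma` holds at `μ = 0` — with the spurious `γ = 0`.**
For `1 ≤ m`, `2 ≤ n - m`, an `L`-polynomial of `(π, π')` at `ν` and a central character of `π'`,
there is EXACTLY ONE `γ` with `HasRSGamma hmn π π' ψ 0 ν γ`, namely `0`
(`hasRSGamma_measure_zero_iff`). Contrast: at `ν = 0` every `γ` qualifies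
(`RankinSelbergLocalGammaCounterexample`). A closed `∃!`-fact can thus be true for the wrong
reason once its measure hypotheses are lost; the intended statement carries `μ` additive Haar. [folklore] -/
theorem existsUnique_hasRSGamma_measure_zero (hm : 0 < m) (hj : 0 < n - m - 1) {P : ℂ[X]}
    (hP : HasRSLFactor hmn π π' ψ ν P)
    (hω : ∃ ω : Subgroup.center (GL (Fin m) F) →* ℂˣ, π'.HasCentralCharacter ω) :
    ∃! γ : RatFunc ℂ, HasRSGamma hmn π π' ψ (0 : Measure F) ν γ :=
  ⟨0, (hasRSGamma_measure_zero_iff hm hj hP 0).2 ⟨rfl, hω⟩,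
    fun _ hγ => hγ.eq_zero_of_measure_zero hm hj hP⟩

/-- **At `μ = 0` every solution of `HasRSEpsilon` has `e = 0`** (`1 ≤ m`, `2 ≤ n - m`): its
`γ = e T^a · L̃/L` vanishes (`HasRSGamma.eq_zero_of_measure_zero`, with the `L`-polynomial the
solution itself provides) while `T^a · L̃/L ≠ 0` (`tateEpsilonRat_ne_zero`, `rsLRatDual_ne_zero`,
`rsLRat_ne_zero`). [folklore] -/
theorem HasRSEpsilon.eq_zero_of_measure_zero (hm : 0 < m) (hj : 0 < n - m - 1) {e : ℂ} {a : ℤ}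
    (h : HasRSEpsilon hmn π π' ψ (0 : Measure F) ν e a) : e = 0 := by
  obtain ⟨P, Pt, hP, hPt, hγ⟩ := h
  have h0 := HasRSGamma.eq_zero_of_measure_zero hm hj hP hγ
  by_contra he
  have hD : rsLRatDual F Pt ≠ 0 :=
    rsLRatDual_ne_zero (by rw [hPt.eval_zero]; exact one_ne_zero)
  exact div_ne_zero (mul_ne_zero (tateEpsilonRat_ne_zero he a) hD) (rsLRat_ne_zero hP.ne_zero) h0

/-- **The solutions of `HasRSEpsilon` at `μ = 0`, exactly** (`1 ≤ m`, `2 ≤ n - m`): `(e, a)` is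
`ε`-data iff `e = 0`, `π'` has a central character, and `L`-polynomials of `(π, π')` and of the
contragredient pair exist at `ν` (`→`: `HasRSEpsilon.eq_zero_of_measure_zero` and the components
of the solution; `←`: `hasRSEpsilon_zero_measure_zero`). The exponent `a` plays no role. [folklore] -/
theorem hasRSEpsilon_measure_zero_iff (hm : 0 < m) (hj : 0 < n - m - 1) (e : ℂ) (a : ℤ) :
    HasRSEpsilon hmn π π' ψ (0 : Measure F) ν e a ↔
      e = 0 ∧ (∃ ω : Subgroup.center (GL (Fin m) F) →* ℂˣ, π'.HasCentralCharacter ω) ∧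
        (∃ P : ℂ[X], HasRSLFactor hmn π π' ψ ν P) ∧
        ∃ Pt : ℂ[X], HasRSLFactor hmn π.contragredientRep π'.contragredientRep ψ⁻¹ ν Pt := by
  refine ⟨fun h => ⟨h.eq_zero_of_measure_zero hm hj, ?_⟩, ?_⟩
  · obtain ⟨P, Pt, hP, hPt, ω, hω, -⟩ := h
    exact ⟨⟨ω, hω⟩, ⟨P, hP⟩, ⟨Pt, hPt⟩⟩
  · rintro ⟨rfl, ⟨ω, hω⟩, ⟨P, hP⟩, ⟨Pt, hPt⟩⟩
    exact hasRSEpsilon_zero_measure_zero hm hj hω hP hPt a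

/-- **`∃! (e, a)` fails at `μ = 0`, for every `ν`** (`1 ≤ m`, `2 ≤ n - m`; no hypothesis on
`π, π', ψ, ν`): a unique solution would have `e = 0` (`HasRSEpsilon.eq_zero_of_measure_zero`),
and then `(0, a + 1)` is a second one (`hasRSEpsilon_zero_iff`). [folklore] -/
theorem not_existsUnique_hasRSEpsilon_measure_zero (hm : 0 < m) (hj : 0 < n - m - 1) :
    ¬ ∃! ea : ℂ × ℤ, HasRSEpsilon hmn π π' ψ (0 : Measure F) ν ea.1 ea.2 := fun hu => by
  obtain ⟨⟨e, a⟩, hea, -⟩ := id hu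
  exact HasRSEpsilon.ne_zero_of_existsUnique hu hea (hea.eq_zero_of_measure_zero hm hj)

/-- **The named fact `existsUnique_hasRSEpsilon` fails at `μ = 0` for EVERY `ν`** (`1 ≤ m`,
`2 ≤ n - m`) as soon as its hypotheses on `π, π', ψ` are met (irreducible admissible generic,
`ψ` non-trivial continuous) — complementing its failure at `ν = 0` for every `μ`
(`not_hasRSEpsilon_zero_measure`, `RankinSelbergLocalUniqueness`). Both measures were meant to be
bound by `[μ.IsAddHaarMeasure]`, `[SMulInvariantMeasure … ν]`, `[IsFiniteMeasureOnCompacts ν]`,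
`[ν.IsOpenPosMeasure]` (Jacquet–Piatetski-Shapiro–Shalika 1983, Thm. 2.7: `dx` Haar, `dh`
invariant), dropped by the `def`. [folklore] -/
theorem not_existsUnique_hasRSEpsilon_measure_zero_of_hyp (hm : 0 < m) (hj : 0 < n - m - 1)
    [π.IsIrreducible] [π'.IsIrreducible] (hπ : π.IsAdmissible) (hπ' : π'.IsAdmissible)
    (hg : IsGeneric π ψ) (hg' : IsGeneric π' ψ⁻¹) (hψ : ψ.IsContinuousNontrivial) :
    ¬ existsUnique_hasRSEpsilon hmn π π' ψ ν (0 : Measure F) := fun h =>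
  not_existsUnique_hasRSEpsilon_measure_zero hm hj (h hπ hπ' hg hg' hψ)

/-- **`hasRSEpsilon_ne_zero` at `μ = 0`, exactly** (`1 ≤ m`, `2 ≤ n - m`, hypotheses on
`π, π', ψ` met): the mis-stated fact instantiated at the zero additive measure holds iff NO
`ε`-data exist there, i.e. (`hasRSEpsilon_measure_zero_iff`) iff `π'` has no central character
or one of the pairs `(π, π')`, `(π̃, π̃')` has no `L`-polynomial at `ν` — the negation of what
Jacquet–Piatetski-Shapiro–Shalika 1983, Thm. 2.7 (i)–(ii) and Schur's lemma provide at the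
invariant `ν` (`→` is `not_hasRSEpsilon_ne_zero_measure_zero` of `RankinSelbergLocalEpsilonProofs`
read contrapositively). [folklore] -/
theorem hasRSEpsilon_ne_zero_measure_zero_iff (hm : 0 < m) (hj : 0 < n - m - 1)
    [π.IsIrreducible] [π'.IsIrreducible] (hπ : π.IsAdmissible) (hπ' : π'.IsAdmissible)
    (hg : IsGeneric π ψ) (hg' : IsGeneric π' ψ⁻¹) (hψ : ψ.IsContinuousNontrivial) :
    hasRSEpsilon_ne_zero (hmn := hmn) (π := π) (π' := π') (ψ := ψ) (ν := ν)
        (μ := (0 : Measure F)) ↔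
      ∀ (e : ℂ) (a : ℤ), ¬ HasRSEpsilon hmn π π' ψ (0 : Measure F) ν e a := by
  refine ⟨fun H e a h => H hπ hπ' hg hg' hψ h (h.eq_zero_of_measure_zero hm hj), fun H => ?_⟩
  intro _ _ _ _ _ _ _ e a h
  exact absurd h (H e a)

end MeasureZero

end Literature.NumberTheory.Automorphic
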